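import Mathlib

/-!
# Stub `stub_absSqrt` for the crux `BrascampLiebVacuum` (line `SketchIdeator2`)

Cauchy–Schwarz over a finite non-negatively weighted family: summing the per-pair bounds
`v_k ≤ 3√(γ_k β_k) + 4 β_k / L` against weights `t_k ≥ 0` gives
`Σ t v ≤ 3 √((Σ t γ)(Σ t β)) + 4 (Σ t β)/L`, because
`(Σ t √(γβ))² ≤ (Σ t γ)(Σ t β)` (Cauchy–Schwarz with `r_k = t_k √(γ_k β_k)`,
`r_k² = (t_k γ_k)(t_k β_k)`).
-/

open scoped BigOperators

namespace Summit.QuantumFields.YangMills.Theorems.BrascampLiebVacuum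

/-- **Stub (elementary, S).** Cauchy–Schwarz over a finite non-negatively weighted family: if every
member satisfies `v_k ≤ 3√(γ_k β_k) + 4 β_k / L` with `v, γ, β ≥ 0` and weights `t ≥ 0`, then
`Σ t v ≤ 3 √((Σ t γ)(Σ t β)) + 4 (Σ t β)/L` (`Σ t√(γβ) = Σ √(tγ)√(tβ) ≤ √(Σtγ) √(Σtβ)`). [folklore] -/
theorem stub_absSqrt :
    ∀ (L : ℝ), 0 < L → ∀ (n : ℕ) (t v γ β : ℕ → ℝ), (∀ k < n, 0 ≤ t k) → (∀ k < n, 0 ≤ v k) →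
      (∀ k < n, 0 ≤ γ k) → (∀ k < n, 0 ≤ β k) →
      (∀ k < n, v k ≤ 3 * Real.sqrt (γ k * β k) + 4 * β k / L) →
      ∑ k ∈ Finset.range n, t k * v k ≤
        3 * Real.sqrt ((∑ k ∈ Finset.range n, t k * γ k) * (∑ k ∈ Finset.range n, t k * β k)) +
          4 * (∑ k ∈ Finset.range n, t k * β k) / L := by
  intro L _ n t v γ β ht _ hγ hβ hle
  -- Step 1: multiply the per-pair bounds by the weights `t k ≥ 0` and sum.
  have h1 : ∑ k ∈ Finset.range n, t k * v k ≤
      ∑ k ∈ Finset.range n, (3 * (t k * Real.sqrt (γ k * β k)) + 4 * (t k * β k) / L) := by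
    refine Finset.sum_le_sum fun k hk => ?_
    rw [Finset.mem_range] at hk
    calc t k * v k ≤ t k * (3 * Real.sqrt (γ k * β k) + 4 * β k / L) :=
          mul_le_mul_of_nonneg_left (hle k hk) (ht k hk)
      _ = 3 * (t k * Real.sqrt (γ k * β k)) + 4 * (t k * β k) / L := by ring
  -- Step 2: Cauchy–Schwarz with `r k = t k * √(γ k * β k)`, `r k ^ 2 = (t k * γ k) * (t k * β k)`.
  have h2 : (∑ k ∈ Finset.range n, t k * Real.sqrt (γ k * β k)) ^ 2 ≤
      (∑ k ∈ Finset.range n, t k * γ k) * (∑ k ∈ Finset.range n, t k * β k) := by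
    refine Finset.sum_sq_le_sum_mul_sum_of_sq_le_mul _ (fun k hk => ?_) (fun k hk => ?_)
      (fun k hk => ?_) <;> rw [Finset.mem_range] at hk
    · exact mul_nonneg (ht k hk) (hγ k hk)
    · exact mul_nonneg (ht k hk) (hβ k hk)
    · rw [mul_pow, Real.sq_sqrt (mul_nonneg (hγ k hk) (hβ k hk))]
      exact le_of_eq (by ring)
  have h3 : ∑ k ∈ Finset.range n, t k * Real.sqrt (γ k * β k) ≤
      Real.sqrt ((∑ k ∈ Finset.range n, t k * γ k) * (∑ k ∈ Finset.range n, t k * β k)) :=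
    Real.le_sqrt_of_sq_le h2
  -- Step 3: assemble.
  calc ∑ k ∈ Finset.range n, t k * v k
      ≤ ∑ k ∈ Finset.range n, (3 * (t k * Real.sqrt (γ k * β k)) + 4 * (t k * β k) / L) := h1
    _ = 3 * (∑ k ∈ Finset.range n, t k * Real.sqrt (γ k * β k)) +
          4 * (∑ k ∈ Finset.range n, t k * β k) / L := by
        rw [Finset.sum_add_distrib, ← Finset.mul_sum, ← Finset.sum_div, ← Finset.mul_sum]
    _ ≤ 3 * Real.sqrt ((∑ k ∈ Finset.range n, t k * γ k) * (∑ k ∈ Finset.range n, t k * β k)) +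
          4 * (∑ k ∈ Finset.range n, t k * β k) / L := by linarith [h3]

end Summit.QuantumFields.YangMills.Theorems.BrascampLiebVacuum
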